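import Summits.QuantumFields.BalabanUV.T4Continuum.Support.AveragingDeficitChartCalculus
import HarnessLib

/-!
# NE7GaugeActionChart — THE FINE GAUGE ACTION IN THE TORUS CHART IS SMOOTH, WITH DIFFERENTIAL `(ζ̇, Φ̇) ↦ Φ̇ − ∇_W ζ̇`: for a base configuration `W` and box size `M`, the map
# `(ζ, Φ) ↦ relLog M W ((chart_W Φ)^{exp ζ})` (box site field `ζ`, chart parameter `Φ`; the gauge `x ↦ e^{ζ(x mod M)}`) is `C^m` at `0` for every `m`, vanishes at `0`, and its derivative
# at `0` is `(ζ̇, Φ̇) ↦ (r, κ) ↦ Φ̇(r,κ) + W(b)⁻¹ζ̇(r)W(b) − ζ̇(r + e_κ mod M)` (`b = (boxVec r, κ)`) — the ONE new nonlinear map of the slice theorem in the C¹ rung of the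
# datum-dependence of `U_k(V)` (ROAD-G114 §7 (P3)): its differential in `ζ̇` is minus the covariant derivative of `ζ̇` along `W`

Cell `pub-balaban`, rung (B)+1 sub-cell t4, lineage `b2b-balaban-t4-ne7-p1` (CRUX PROVER NE7 #1 = OWNER of BINDER row NE7), generation 114.  Memo `t4/b2b-balaban-t4-ne7-p1-g114/ROAD-G114.md` §7.
Ingredients: `analyticAt_mlog`, `hasFDerivAt_mlog_one` (the series (21)), Mathlib's `exp_analytic` ∕ `hasDerivAt_exp_smul_const`, `contDiffAt_val_chart`.
WHAT ([folklore]; 0 def, 0 sorry; any `d`, any box size `M ≥ 1`, any base `W`).  `contDiffAt_gaugeChart`, `gaugeChart_zero`, `hasDerivAt_gaugeChart_gauge`, `hasDerivAt_gaugeChart_chart`,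
**`fderiv_gaugeChart_apply`**.
HONEST FRAMING (page 1): elementary calculus in the chart; nothing of Bałaban's; NOT NE7, NOT NE3; spine 0∕9; finite T⁴ rung (B)+1 — NOT infinite volume, NOT mass gap, NOT BetaPertH, NOT Clay.
-/

set_option autoImplicit false

open scoped BigOperators Matrix Matrix.Norms.L2Operator Topology
open NormedSpace Finset Filter

namespace Summit.QuantumFields.BalabanUV.T4Continuum.NE7GaugeActionChart

open Literature.MathematicalPhysics.QuantumFieldTheory.Balaban1983to89
open B7Prop1Explicit B7Prop2Explicit MatrixLog
open AveragingDeficitTorusChart (TDir redN redN_boxVec chart chartDir chart_zero)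
open AveragingDeficitChartCalculus (relLog contDiffAt_val_chart hasFDerivAt_mlog_one hasDerivAt_comp_smul)

noncomputable section

variable {d : ℕ} {n : Type*} [Fintype n] [DecidableEq n]

/-! ## §1 The map and its value at `0` -/

/-- The bond variable of `(chart_W Φ)^{exp ζ}` relative to `W` at the box bond `(boxVec r, κ)`, written out. [folklore] -/
theorem gaugeChart_val (M : ℕ) [NeZero M] (W : Site d → Fin d → (Matrix n n ℂ)ˣ) (ζ : (Fin d → Fin M) → (Matrix n n ℂ)) (Φ : TDir d n M) (r : Fin d → Fin M) (κ : Fin d) :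
    (((W (boxVec M r) κ)⁻¹ : (Matrix n n ℂ)ˣ) : (Matrix n n ℂ)) * ((gaugeAct (fun x : Site d => expUnit (ζ (redN M x))) (chart (ContinuousLinearMap.id ℝ (Matrix n n ℂ)) M W Φ) (boxVec M r) κ : (Matrix n n ℂ)ˣ) : (Matrix n n ℂ))
      = (((W (boxVec M r) κ)⁻¹ : (Matrix n n ℂ)ˣ) : (Matrix n n ℂ)) * (exp (ζ r) * ((W (boxVec M r) κ : (Matrix n n ℂ)) * exp (Φ r κ)) * exp (-(ζ (redN M (boxVec M r + e κ))))) := by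
  simp only [gaugeAct, chart, chartDir, Units.val_mul, val_expUnit, val_inv_expUnit, ContinuousLinearMap.id_apply, redN_boxVec]

/-- The map vanishes at `0`: `relLog M W ((chart_W 0)^{exp 0}) = 0`. [folklore] -/
theorem gaugeChart_zero (M : ℕ) [NeZero M] (W : Site d → Fin d → (Matrix n n ℂ)ˣ) :
    relLog M W (gaugeAct (fun x : Site d => expUnit ((0 : (Fin d → Fin M) → (Matrix n n ℂ)) (redN M x))) (chart (ContinuousLinearMap.id ℝ (Matrix n n ℂ)) M W 0)) = 0 := by
  funext r κ
  have e1 := congrArg mlog (gaugeChart_val M W (0 : (Fin d → Fin M) → (Matrix n n ℂ)) (0 : TDir d n M) r κ)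
  refine e1.trans ?_
  have e2 : (((W (boxVec M r) κ)⁻¹ : (Matrix n n ℂ)ˣ) : (Matrix n n ℂ)) * (exp ((0 : (Fin d → Fin M) → (Matrix n n ℂ)) r) * ((W (boxVec M r) κ : (Matrix n n ℂ)) * exp ((0 : TDir d n M) r κ))
      * exp (-((0 : (Fin d → Fin M) → (Matrix n n ℂ)) (redN M (boxVec M r + e κ))))) = 1 := by
    rw [Pi.zero_apply, Pi.zero_apply, Pi.zero_apply, Pi.zero_apply, exp_zero, neg_zero, exp_zero, one_mul, mul_one, mul_one, Units.inv_mul]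
  rw [e2]
  exact AveragingDeficitChartCalculus.mlog_one

/-! ## §2 Smoothness -/

/-- **THE GAUGE ACTION IN THE CHART IS `C^m` AT `0`** (every `m`). [folklore] -/
theorem contDiffAt_gaugeChart {m : WithTop ℕ∞} (M : ℕ) [NeZero M] (W : Site d → Fin d → (Matrix n n ℂ)ˣ) :
    ContDiffAt ℝ m (fun p : ((Fin d → Fin M) → (Matrix n n ℂ)) × TDir d n M =>
      relLog M W (gaugeAct (fun x : Site d => expUnit (p.1 (redN M x))) (chart (ContinuousLinearMap.id ℝ (Matrix n n ℂ)) M W p.2))) 0 := by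
  rw [contDiffAt_pi]
  intro r
  rw [contDiffAt_pi]
  intro κ
  have hfe : (fun p : ((Fin d → Fin M) → (Matrix n n ℂ)) × TDir d n M =>
      relLog M W (gaugeAct (fun x : Site d => expUnit (p.1 (redN M x))) (chart (ContinuousLinearMap.id ℝ (Matrix n n ℂ)) M W p.2)) r κ)
      = fun p => mlog ((((W (boxVec M r) κ)⁻¹ : (Matrix n n ℂ)ˣ) : (Matrix n n ℂ)) * (exp (p.1 r) * ((W (boxVec M r) κ : (Matrix n n ℂ)) * exp (p.2 r κ)) * exp (-(p.1 (redN M (boxVec M r + e κ)))))) :=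
    funext fun p => congrArg mlog (gaugeChart_val M W p.1 p.2 r κ)
  rw [hfe]
  -- the inner product of smooth factors, value `1` at `p = 0`
  have h1 : ContDiffAt ℝ m (fun p : ((Fin d → Fin M) → (Matrix n n ℂ)) × TDir d n M => exp (p.1 r)) 0 :=
    (exp_analytic (𝕂 := ℝ) _).contDiffAt.comp 0 ((contDiff_apply ℝ (Matrix n n ℂ) r).comp contDiff_fst).contDiffAt
  have h2 : ContDiffAt ℝ m (fun p : ((Fin d → Fin M) → (Matrix n n ℂ)) × TDir d n M => exp (-(p.1 (redN M (boxVec M r + e κ))))) 0 :=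
    (exp_analytic (𝕂 := ℝ) _).contDiffAt.comp 0 ((contDiff_apply ℝ (Matrix n n ℂ) (redN M (boxVec M r + e κ))).comp contDiff_fst).neg.contDiffAt
  have h3 : ContDiffAt ℝ m (fun p : ((Fin d → Fin M) → (Matrix n n ℂ)) × TDir d n M => exp (p.2 r κ)) 0 :=
    (exp_analytic (𝕂 := ℝ) _).contDiffAt.comp 0 ((contDiff_apply_apply ℝ (Matrix n n ℂ) r κ).comp contDiff_snd).contDiffAt
  have hprod : ContDiffAt ℝ m (fun p : ((Fin d → Fin M) → (Matrix n n ℂ)) × TDir d n M =>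
      (((W (boxVec M r) κ)⁻¹ : (Matrix n n ℂ)ˣ) : (Matrix n n ℂ)) * (exp (p.1 r) * ((W (boxVec M r) κ : (Matrix n n ℂ)) * exp (p.2 r κ)) * exp (-(p.1 (redN M (boxVec M r + e κ)))))) 0 :=
    contDiffAt_const.mul ((h1.mul (contDiffAt_const.mul h3)).mul h2)
  have hval : (((W (boxVec M r) κ)⁻¹ : (Matrix n n ℂ)ˣ) : (Matrix n n ℂ)) * (exp ((0 : ((Fin d → Fin M) → (Matrix n n ℂ)) × TDir d n M).1 r) * ((W (boxVec M r) κ : (Matrix n n ℂ)) * exp ((0 : ((Fin d → Fin M) → (Matrix n n ℂ)) × TDir d n M).2 r κ))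
      * exp (-((0 : ((Fin d → Fin M) → (Matrix n n ℂ)) × TDir d n M).1 (redN M (boxVec M r + e κ))))) = 1 := by
    simp only [Prod.fst_zero, Prod.snd_zero, Pi.zero_apply, exp_zero, neg_zero, one_mul, mul_one, Units.inv_mul]
  have hlog : ContDiffAt ℝ m (mlog : (Matrix n n ℂ) → (Matrix n n ℂ)) ((((W (boxVec M r) κ)⁻¹ : (Matrix n n ℂ)ˣ) : (Matrix n n ℂ)) * (exp ((0 : ((Fin d → Fin M) → (Matrix n n ℂ)) × TDir d n M).1 r)
      * ((W (boxVec M r) κ : (Matrix n n ℂ)) * exp ((0 : ((Fin d → Fin M) → (Matrix n n ℂ)) × TDir d n M).2 r κ)) * exp (-((0 : ((Fin d → Fin M) → (Matrix n n ℂ)) × TDir d n M).1 (redN M (boxVec M r + e κ)))))) := by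
    rw [hval]
    exact ((analyticAt_mlog (X := (1 : (Matrix n n ℂ))) (by rw [sub_self, norm_zero]; norm_num)).contDiffAt).restrict_scalars ℝ
  have hc := ContDiffAt.comp (g := (mlog : (Matrix n n ℂ) → (Matrix n n ℂ))) (0 : ((Fin d → Fin M) → (Matrix n n ℂ)) × TDir d n M) hlog hprod
  exact hc

/-! ## §3 The differential: gauge directions give `−∇_W ζ̇`, chart directions give the identity -/

/-- Along a gauge direction: `d∕dt|₀ relLog M W ((chart_W 0)^{exp tζ̇})(r,κ) = W(b)⁻¹ζ̇(r)W(b) − ζ̇(r + e_κ mod M)`. [folklore] -/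
theorem hasDerivAt_gaugeChart_gauge (M : ℕ) [NeZero M] (W : Site d → Fin d → (Matrix n n ℂ)ˣ) (ζ : (Fin d → Fin M) → (Matrix n n ℂ)) (r : Fin d → Fin M) (κ : Fin d) :
    HasDerivAt (fun t : ℝ => relLog M W (gaugeAct (fun x : Site d => expUnit ((t • ζ) (redN M x))) (chart (ContinuousLinearMap.id ℝ (Matrix n n ℂ)) M W 0)) r κ)
      ((((W (boxVec M r) κ)⁻¹ : (Matrix n n ℂ)ˣ) : (Matrix n n ℂ)) * ζ r * (W (boxVec M r) κ : (Matrix n n ℂ)) - ζ (redN M (boxVec M r + e κ))) 0 := by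
  set Wb : (Matrix n n ℂ) := (W (boxVec M r) κ : (Matrix n n ℂ)) with hWb
  set Wi : (Matrix n n ℂ) := (((W (boxVec M r) κ)⁻¹ : (Matrix n n ℂ)ˣ) : (Matrix n n ℂ)) with hWi
  set A : (Matrix n n ℂ) := ζ r with hA
  set B : (Matrix n n ℂ) := ζ (redN M (boxVec M r + e κ)) with hB
  have hWiWb : Wi * Wb = 1 := by rw [hWi, hWb, Units.inv_mul]
  have hfe : (fun t : ℝ => relLog M W (gaugeAct (fun x : Site d => expUnit ((t • ζ) (redN M x))) (chart (ContinuousLinearMap.id ℝ (Matrix n n ℂ)) M W 0)) r κ)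
      = fun t : ℝ => mlog (Wi * (exp (t • A) * Wb * exp (-(t • B)))) := by
    funext t
    refine (congrArg mlog (gaugeChart_val M W (t • ζ) (0 : TDir d n M) r κ)).trans ?_
    simp only [Pi.smul_apply, Pi.zero_apply, exp_zero, mul_one, hWi, hWb, hA, hB]
  rw [hfe]
  -- the inner curve `h(t) = W⁻¹ (e^{tA} W e^{−tB})` and its derivative at `0`
  have hA' : HasDerivAt (fun t : ℝ => exp (t • A)) A 0 := by
    have h := hasDerivAt_exp_smul_const (𝕂 := ℝ) A (0 : ℝ); rwa [zero_smul, exp_zero, one_mul] at h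
  have hB' : HasDerivAt (fun t : ℝ => exp (-(t • B))) (-B) 0 := by
    have h := hasDerivAt_exp_smul_const (𝕂 := ℝ) (-B) (0 : ℝ)
    rw [zero_smul, exp_zero, one_mul] at h
    refine h.congr_of_eventuallyEq (Filter.Eventually.of_forall fun t => ?_)
    simp only [smul_neg]
  have hcurve : HasDerivAt (fun t : ℝ => Wi * (exp (t • A) * Wb * exp (-(t • B))))
      (Wi * (A * Wb * exp (-((0 : ℝ) • B)) + exp ((0 : ℝ) • A) * Wb * -B)) 0 := by
    have h1 : HasDerivAt (fun t : ℝ => exp (t • A) * Wb) (A * Wb) 0 := hA'.mul_const Wb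
    have h2 := h1.mul hB'
    exact h2.const_mul Wi
  have hval0 : Wi * (exp ((0 : ℝ) • A) * Wb * exp (-((0 : ℝ) • B))) = 1 := by
    simp only [zero_smul, exp_zero, one_mul, neg_zero, mul_one, hWi, hWb, Units.inv_mul]
  -- `log` at `1` has the identity as derivative
  have hlog : HasFDerivAt (mlog : (Matrix n n ℂ) → (Matrix n n ℂ)) ((ContinuousLinearMap.id ℂ (Matrix n n ℂ)).restrictScalars ℝ) (Wi * (exp ((0 : ℝ) • A) * Wb * exp (-((0 : ℝ) • B)))) := by
    rw [hval0]; exact hasFDerivAt_mlog_one.restrictScalars ℝ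
  have h := hlog.comp_hasDerivAt (0 : ℝ) hcurve
  rw [ContinuousLinearMap.coe_restrictScalars', ContinuousLinearMap.coe_id', id] at h
  have hder : Wi * (A * Wb * exp (-((0 : ℝ) • B)) + exp ((0 : ℝ) • A) * Wb * -B) = Wi * A * Wb - B := by
    simp only [zero_smul, neg_zero, exp_zero, mul_one, one_mul, mul_add, mul_neg, ← mul_assoc, hWiWb]
    abel
  exact h.congr_deriv hder

/-- Along a chart direction: `d∕dt|₀ relLog M W ((chart_W (tΦ̇))^{1})(r,κ) = Φ̇(r,κ)`. [folklore] -/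
theorem hasDerivAt_gaugeChart_chart (M : ℕ) [NeZero M] (W : Site d → Fin d → (Matrix n n ℂ)ˣ) (Φ : TDir d n M) (r : Fin d → Fin M) (κ : Fin d) :
    HasDerivAt (fun t : ℝ => relLog M W (gaugeAct (fun x : Site d => expUnit ((0 : (Fin d → Fin M) → (Matrix n n ℂ)) (redN M x))) (chart (ContinuousLinearMap.id ℝ (Matrix n n ℂ)) M W (t • Φ))) r κ)
      (Φ r κ) 0 := by
  have hfe : (fun t : ℝ => relLog M W (gaugeAct (fun x : Site d => expUnit ((0 : (Fin d → Fin M) → (Matrix n n ℂ)) (redN M x))) (chart (ContinuousLinearMap.id ℝ (Matrix n n ℂ)) M W (t • Φ))) r κ)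
      = fun t : ℝ => mlog (exp (t • Φ r κ)) := by
    funext t
    refine (congrArg mlog (gaugeChart_val M W (0 : (Fin d → Fin M) → (Matrix n n ℂ)) (t • Φ) r κ)).trans ?_
    simp only [Pi.zero_apply, exp_zero, neg_zero, one_mul, mul_one, ← mul_assoc, Units.inv_mul, Pi.smul_apply]
  rw [hfe]
  have hA' : HasDerivAt (fun t : ℝ => exp (t • Φ r κ)) (Φ r κ) 0 := by
    have h := hasDerivAt_exp_smul_const (𝕂 := ℝ) (Φ r κ) (0 : ℝ); rwa [zero_smul, exp_zero, one_mul] at h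
  have hlog : HasFDerivAt (mlog : (Matrix n n ℂ) → (Matrix n n ℂ)) ((ContinuousLinearMap.id ℂ (Matrix n n ℂ)).restrictScalars ℝ) (exp ((0 : ℝ) • Φ r κ)) := by
    rw [zero_smul, exp_zero]; exact hasFDerivAt_mlog_one.restrictScalars ℝ
  have h := hlog.comp_hasDerivAt (0 : ℝ) hA'
  rw [ContinuousLinearMap.coe_restrictScalars', ContinuousLinearMap.coe_id', id] at h
  exact h

/-- **THE DIFFERENTIAL OF THE GAUGE ACTION IN THE CHART AT `0`**: `D(0)(ζ̇, Φ̇)(r,κ) = Φ̇(r,κ) + (W(b)⁻¹ζ̇(r)W(b) − ζ̇(r + e_κ mod M))`. [folklore] -/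
theorem fderiv_gaugeChart_apply (M : ℕ) [NeZero M] (W : Site d → Fin d → (Matrix n n ℂ)ˣ) (ζ : (Fin d → Fin M) → (Matrix n n ℂ)) (Φ : TDir d n M) (r : Fin d → Fin M) (κ : Fin d) :
    (fderiv ℝ (fun p : ((Fin d → Fin M) → (Matrix n n ℂ)) × TDir d n M =>
      relLog M W (gaugeAct (fun x : Site d => expUnit (p.1 (redN M x))) (chart (ContinuousLinearMap.id ℝ (Matrix n n ℂ)) M W p.2))) 0) (ζ, Φ) r κ
      = Φ r κ + ((((W (boxVec M r) κ)⁻¹ : (Matrix n n ℂ)ˣ) : (Matrix n n ℂ)) * ζ r * (W (boxVec M r) κ : (Matrix n n ℂ)) - ζ (redN M (boxVec M r + e κ))) := by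
  set G : ((Fin d → Fin M) → (Matrix n n ℂ)) × TDir d n M → TDir d n M := fun p =>
    relLog M W (gaugeAct (fun x : Site d => expUnit (p.1 (redN M x))) (chart (ContinuousLinearMap.id ℝ (Matrix n n ℂ)) M W p.2)) with hG
  have hGd : HasFDerivAt G (fderiv ℝ G 0) 0 := ((contDiffAt_gaugeChart (m := 1) M W).differentiableAt (by norm_num)).hasFDerivAt
  -- directional derivatives through the Fréchet derivative, component by component
  have hcomp : ∀ q : ((Fin d → Fin M) → (Matrix n n ℂ)) × TDir d n M, HasDerivAt (fun t : ℝ => G (t • q) r κ) ((fderiv ℝ G 0) q r κ) 0 := by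
    intro q
    have h := hasDerivAt_comp_smul hGd q
    have h1 : HasDerivAt (fun t : ℝ => (fun f : TDir d n M => f r κ) (G (t • q))) ((fderiv ℝ G 0) q r κ) 0 :=
      ((ContinuousLinearMap.proj κ).comp (ContinuousLinearMap.proj (R := ℝ) (φ := fun _ : Fin d → Fin M => Fin d → (Matrix n n ℂ)) r)).hasFDerivAt.comp_hasDerivAt 0 h
    exact h1
  -- the gauge direction
  have hζ : (fderiv ℝ G 0) (ζ, 0) r κ = (((W (boxVec M r) κ)⁻¹ : (Matrix n n ℂ)ˣ) : (Matrix n n ℂ)) * ζ r * (W (boxVec M r) κ : (Matrix n n ℂ)) - ζ (redN M (boxVec M r + e κ)) := by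
    have h1 := hcomp (ζ, 0)
    have h2 := hasDerivAt_gaugeChart_gauge M W ζ r κ
    have e : (fun t : ℝ => G (t • (ζ, (0 : TDir d n M))) r κ)
        = fun t : ℝ => relLog M W (gaugeAct (fun x : Site d => expUnit ((t • ζ) (redN M x))) (chart (ContinuousLinearMap.id ℝ (Matrix n n ℂ)) M W 0)) r κ := by
      funext t; simp only [hG, Prod.smul_mk, smul_zero]
    rw [e] at h1
    exact h1.unique h2
  -- the chart direction
  have hΦ : (fderiv ℝ G 0) (0, Φ) r κ = Φ r κ := by
    have h1 := hcomp (0, Φ)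
    have h2 := hasDerivAt_gaugeChart_chart M W Φ r κ
    have e : (fun t : ℝ => G (t • ((0 : (Fin d → Fin M) → (Matrix n n ℂ)), Φ)) r κ)
        = fun t : ℝ => relLog M W (gaugeAct (fun x : Site d => expUnit ((0 : (Fin d → Fin M) → (Matrix n n ℂ)) (redN M x))) (chart (ContinuousLinearMap.id ℝ (Matrix n n ℂ)) M W (t • Φ))) r κ := by
      funext t; simp only [hG, Prod.smul_mk, smul_zero]
    rw [e] at h1
    exact h1.unique h2
  have hsum : (fderiv ℝ G 0) (ζ, Φ) = (fderiv ℝ G 0) (0, Φ) + (fderiv ℝ G 0) (ζ, 0) := by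
    rw [← map_add]; congr 1; simp
  show (fderiv ℝ G 0) (ζ, Φ) r κ = _
  rw [hsum, Pi.add_apply, Pi.add_apply, hΦ, hζ]

end

end Summit.QuantumFields.BalabanUV.T4Continuum.NE7GaugeActionChart
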